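/-
Copyright (c) 2026. All rights reserved.
Released under Apache 2.0 license as described in the file LICENSE.
-/
import Literature.MathematicalPhysics.QuantumFieldTheory.Balaban1983to89.B4Lemma22SupStair

/-!
# B4 Lemma 2.2 (2.17), `q = p = 1`, BY DUALITY: `‖G_k(□,Ã)f‖₁ ≤ c‖f‖₁` AND THE THIRD MEMBER
`‖G_k(□,Ã)D^{η*}_{Ã,μ}f‖₁ ≤ c‖f‖₁`, FROM THE SUP-NORM CLAUSES AND THE SYMMETRY OF `H_k(□,Ã)`

[B4] = T. Bałaban, *(Higgs)₂,₃ quantum fields in a finite volume. III. Regularity and decay of lattice Green's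
functions*, Commun. Math. Phys. **89** (1983) 571–597 (bib key `Balaban1983RegularityDecay`).

## The printed statement («» = quotation units, transcript-B4.md ll. 104–110)

Lemma 2.2, p. 578: «and a constant c₂ depending on d, p₁, such that
(2.17) ‖G_k(□,Ã)f‖_q, ‖D^η_{Ã,μ}G_k(□,Ã)f‖_q, ‖G_k(□,Ã)D^{η*}_{Ã,μ}f‖_q ≤ c₂‖f‖_p
for 1 ≤ p, q ≤ ∞, satisfying the condition 1/p − 1/p₁ ≤ 1/q ≤ 1/p with p₁ > d.»; p. 572: (1.3)
«⟨φ, (−Δ^{η,N}_{A,Ω})φ⟩ = Σ_{b⊂Ω} η^d |(D^η_Aφ)(b)|²», (1.5) «P_k(A) = Q_k^*(A) Q_k(A)», (1.6) «G_k(Ω, A) =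
(−Δ^{η,N}_{A,Ω} + m² + aP_k(A))^{−1}» (transcript-B4.md ll. 13–16).

## What this file certifies (kernel form; the lineage's typed objects)

The case `q = p = 1` of (2.17) (allowed by the printed condition: `1/p − 1/p₁ ≤ 1 = 1/q = 1/p`) for the first and
the THIRD member, obtained from the `q = p = ∞` clauses of `B4Lemma22SupStair.lemma22_17_sup_stair` (first and
second member) by transposition:
* §1 SYMMETRY of the lineage's operator: `covLap_transpose`, `projOp_transpose`, `covOp_transpose`,
  `b4Op_transpose`, `b4Green_transpose` — `H = Σ c·BᵀB + m² + a·QᵀQ` is symmetric, hence so is `G = H^{-1}`;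
* §2 DUALITY between the mixed norms `‖·‖_∞ = supN` and `‖·‖₁ = l1N` of `B4Lemma22Reduce231` (sup / sum over sites
  of the Euclidean colour norm): `dot_le_siteNorm_mul` (Cauchy–Schwarz per site), `dotProduct_le_supN_mul_l1N`
  (`⟨Φ,Ψ⟩ ≤ ‖Φ‖_∞‖Ψ‖₁`), the dual witness `dualW u = (u(x)/|u(x)|)_x` with `‖dualW u‖_∞ ≤ 1`,
  `⟨dualW u, u⟩ = ‖u‖₁`, and `l1N_transpose_le`: `‖M‖_{∞→∞} ≤ C ⇒ ‖Mᵀ‖_{1→1} ≤ C`;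
* §3 `lemma22_17_l1_stair`: under exactly the hypotheses of `lemma22_17_sup_stair` (window, (2.23)-type size /
  derivative / boundary conditions on `A'`, two explicit smallness inequalities), for every `f`:
  `‖Gf‖₁ ≤ 2(d+2)c‖f‖₁` and `‖G(D^η_{Ã,μ})ᵀf‖₁ ≤ (1+ℓ₁θ)·2(d+2)c‖f‖₁`, `G = G_k(□,Ã)` with the staircase
  contours; here `(D^η_{Ã,μ})ᵀ` is the real adjoint `D^{η*}_{Ã,μ}` of the lineage's covariant derivative (the
  printed third member of (2.17) at `q = p = 1`).

## Honest scope

(a) Only `q = p = 1` for the first and third members (and, from the parent, `q = p = ∞` for the first and second);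
the second member at `q = p = 1` and the third at `q = p = ∞` (which are dual to each other), the general `(p,q)`
range and the Hölder clause (2.16) are NOT treated. (b) `D^{η*}` is rendered as the matrix transpose (the adjoint
for the unweighted real inner product on `□ × colours`; [B4]'s `η^d`-weighted pairing gives the same adjoint).
(c) Boxes with the lineage's staircase contours only; constants explicit, unoptimised. No manuscript step is used
as a hypothesis of a theorem claiming a printed conclusion; 0 cited facts; every theorem is proved from the
lineage's definitions.
-/

namespace Literature.MathematicalPhysics.QuantumFieldTheory.Balaban1983to89.B4Lemma22DualL1

open Finset Matrix
open Literature.MathematicalPhysics.QuantumFieldTheory.Balaban1983to89.B4GaugeCovariance (fld fld_apply OrthFlow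
  fieldLink constBond covLap projOp covOp b4Op b4Green)
open Literature.MathematicalPhysics.QuantumFieldTheory.Balaban1983to89.B4Lower18Regular (e1 baseEmb stairContour)
open Literature.MathematicalPhysics.QuantumFieldTheory.Balaban1983to89.B4Lemma21Region (siteNorm)
open Literature.MathematicalPhysics.QuantumFieldTheory.Balaban1983to89.B4Reflection242 (nbrs boxDom)
open Literature.MathematicalPhysics.QuantumFieldTheory.Balaban1983to89.B4Lemma22Reduce231 (supN l1N le_supN supN_le
  supN_nonneg l1N_nonneg siteNorm_nonneg siteNorm_smul)
open Literature.MathematicalPhysics.QuantumFieldTheory.Balaban1983to89.B4Lemma22ReduceZero (Box greenA derivA)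
open Literature.MathematicalPhysics.QuantumFieldTheory.Balaban1983to89.B4Lemma22SupStair (lemma22_17_sup_stair)

noncomputable section

section Symm

variable {X Y : Type*} [Fintype X] [Fintype Y] [DecidableEq X] {ι : Type} [Fintype ι] [DecidableEq ι]

/-! ## §1 SYMMETRY OF `H_k(Ω,A)` AND OF `G_k(Ω,A)` -/

/-- `(−Δ_W)ᵀ = −Δ_W` (`−Δ_W = Σ_{x,y} c(x,y)·B_{xy}ᵀB_{xy}`). [cite: Balaban1983RegularityDecay, p. 572 (1.3)] -/
theorem covLap_transpose (c : X → X → ℝ) (W : X → X → Matrix ι ι ℝ) : (covLap c W)ᵀ = covLap c W := by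
  unfold covLap
  rw [Matrix.transpose_sum]
  refine Finset.sum_congr rfl fun x _ => ?_
  rw [Matrix.transpose_sum]
  refine Finset.sum_congr rfl fun y _ => ?_
  rw [Matrix.transpose_smul, Matrix.transpose_mul, Matrix.transpose_transpose]

omit [Fintype X] [DecidableEq X] [DecidableEq ι] in
/-- `P_k(A)ᵀ = P_k(A)` (`P = QᵀQ`). [cite: Balaban1983RegularityDecay, p. 572 (1.5)] -/
theorem projOp_transpose (q : Y → X → ℝ) (T : Y → X → Matrix ι ι ℝ) : (projOp q T)ᵀ = projOp q T := by
  unfold projOp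
  rw [Matrix.transpose_mul, Matrix.transpose_transpose]

/-- `(−Δ_W + m² + aP)ᵀ = −Δ_W + m² + aP`. [cite: Balaban1983RegularityDecay, p. 572 (1.6)] -/
theorem covOp_transpose (c : X → X → ℝ) (m2 a : ℝ) (q : Y → X → ℝ) (W : X → X → Matrix ι ι ℝ)
    (T : Y → X → Matrix ι ι ℝ) : (covOp c m2 a q W T)ᵀ = covOp c m2 a q W T := by
  unfold covOp
  rw [Matrix.transpose_add, Matrix.transpose_add, Matrix.transpose_smul, Matrix.transpose_smul,
    Matrix.transpose_one, covLap_transpose, projOp_transpose]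

/-- [B4]'s `H_k(Ω,A)` is symmetric. [cite: Balaban1983RegularityDecay, p. 572 (1.6)] -/
theorem b4Op_transpose (F : OrthFlow ι) (κ : ℝ) (c : X → X → ℝ) (m2 a : ℝ) (q : Y → X → ℝ) (emb : Y → X)
    (Γ : Y → X → List X) (A : X → X → ℝ) : (b4Op F κ c m2 a q emb Γ A)ᵀ = b4Op F κ c m2 a q emb Γ A := by
  unfold b4Op
  exact covOp_transpose _ _ _ _ _ _

/-- [B4]'s `G_k(Ω,A) = H_k(Ω,A)^{-1}` is symmetric. [cite: Balaban1983RegularityDecay, p. 572 (1.6)] -/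
theorem b4Green_transpose (F : OrthFlow ι) (κ : ℝ) (c : X → X → ℝ) (m2 a : ℝ) (q : Y → X → ℝ) (emb : Y → X)
    (Γ : Y → X → List X) (A : X → X → ℝ) :
    (b4Green F κ c m2 a q emb Γ A)ᵀ = b4Green F κ c m2 a q emb Γ A := by
  unfold b4Green
  rw [Matrix.transpose_nonsing_inv, b4Op_transpose]

end Symm

section Dual

variable {X : Type*} [Fintype X] {ι : Type} [Fintype ι]

/-! ## §2 DUALITY `‖M‖_{∞→∞} ≤ C ⇒ ‖Mᵀ‖_{1→1} ≤ C` FOR THE MIXED NORMS -/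

/-- `⟨Φ,Ψ⟩ = Σ_x ⟨φ(x),ψ(x)⟩`. [folklore] -/
theorem dotProduct_eq_sum_fld (Φ Ψ : X × ι → ℝ) : Φ ⬝ᵥ Ψ = ∑ x, fld Φ x ⬝ᵥ fld Ψ x := by
  simp only [dotProduct, Fintype.sum_prod_type, fld_apply]

/-- Cauchy–Schwarz per site: `⟨v,w⟩ ≤ |v||w|`. [folklore] -/
theorem dot_le_siteNorm_mul (v w : ι → ℝ) : v ⬝ᵥ w ≤ siteNorm v * siteNorm w := by
  have h := Real.sum_mul_le_sqrt_mul_sqrt Finset.univ v w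
  have e1 : ∑ i, v i ^ 2 = v ⬝ᵥ v := by simp only [dotProduct, sq]
  have e2 : ∑ i, w i ^ 2 = w ⬝ᵥ w := by simp only [dotProduct, sq]
  rw [e1, e2] at h
  unfold siteNorm
  exact h

/-- `⟨Φ,Ψ⟩ ≤ ‖Φ‖_∞‖Ψ‖₁`. [folklore] -/
theorem dotProduct_le_supN_mul_l1N (Φ Ψ : X × ι → ℝ) : Φ ⬝ᵥ Ψ ≤ supN Φ * l1N Ψ := by
  rw [dotProduct_eq_sum_fld]
  unfold l1N
  rw [Finset.mul_sum]
  exact Finset.sum_le_sum fun x _ =>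
    (dot_le_siteNorm_mul _ _).trans (mul_le_mul_of_nonneg_right (le_supN Φ x) (siteNorm_nonneg _))

/-- the dual witness `(u(x)/|u(x)|)_x` (zero where `u(x) = 0`). [folklore] -/
def dualW (u : X × ι → ℝ) : X × ι → ℝ := fun p => (siteNorm (fld u p.1))⁻¹ * u p

omit [Fintype X] in
/-- site components of the dual witness. [folklore] -/
theorem fld_dualW (u : X × ι → ℝ) (x : X) : fld (dualW u) x = (siteNorm (fld u x))⁻¹ • fld u x := by
  ext i
  simp only [fld_apply, dualW, Pi.smul_apply, smul_eq_mul]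

omit [Fintype X] in
/-- `|dualW u (x)| ≤ 1`. [folklore] -/
theorem siteNorm_dualW_le (u : X × ι → ℝ) (x : X) : siteNorm (fld (dualW u) x) ≤ 1 := by
  rw [fld_dualW, siteNorm_smul]
  by_cases h : siteNorm (fld u x) = 0
  · rw [h, _root_.inv_zero, abs_zero, zero_mul]
    exact zero_le_one
  · rw [abs_of_nonneg (inv_nonneg.2 (siteNorm_nonneg _)), inv_mul_cancel₀ h]

omit [Fintype X] in
/-- `‖dualW u‖_∞ ≤ 1`. [folklore] -/
theorem supN_dualW_le (u : X × ι → ℝ) : supN (dualW u) ≤ 1 := supN_le zero_le_one (siteNorm_dualW_le u)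

/-- `⟨dualW u, u⟩ = ‖u‖₁`. [folklore] -/
theorem dualW_dot (u : X × ι → ℝ) : dualW u ⬝ᵥ u = l1N u := by
  rw [dotProduct_eq_sum_fld]
  unfold l1N
  refine Finset.sum_congr rfl fun x _ => ?_
  rw [fld_dualW, smul_dotProduct, smul_eq_mul]
  have h0 : 0 ≤ fld u x ⬝ᵥ fld u x := Finset.sum_nonneg fun i _ => mul_self_nonneg _
  have hsq : fld u x ⬝ᵥ fld u x = siteNorm (fld u x) ^ 2 := by
    unfold siteNorm
    rw [Real.sq_sqrt h0]
  rw [hsq]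
  by_cases h : siteNorm (fld u x) = 0
  · rw [h]; simp
  · rw [sq, ← mul_assoc, inv_mul_cancel₀ h, one_mul]

/-- **DUALITY**: if `‖MΦ‖_∞ ≤ C‖Φ‖_∞` for all `Φ` (`C ≥ 0`), then `‖Mᵀu‖₁ ≤ C‖u‖₁` for all `u`. [folklore] -/
theorem l1N_transpose_le {M : Matrix (X × ι) (X × ι) ℝ} {C : ℝ} (hC : 0 ≤ C)
    (h : ∀ Φ, supN (M *ᵥ Φ) ≤ C * supN Φ) (u : X × ι → ℝ) : l1N (Mᵀ *ᵥ u) ≤ C * l1N u := by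
  have h1 : l1N (Mᵀ *ᵥ u) = (M *ᵥ dualW (Mᵀ *ᵥ u)) ⬝ᵥ u := by
    rw [← dualW_dot, Matrix.dotProduct_mulVec, Matrix.vecMul_transpose]
  rw [h1]
  calc (M *ᵥ dualW (Mᵀ *ᵥ u)) ⬝ᵥ u ≤ supN (M *ᵥ dualW (Mᵀ *ᵥ u)) * l1N u :=
        dotProduct_le_supN_mul_l1N _ _
    _ ≤ C * supN (dualW (Mᵀ *ᵥ u)) * l1N u := mul_le_mul_of_nonneg_right (h _) (l1N_nonneg u)
    _ ≤ C * 1 * l1N u :=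
        mul_le_mul_of_nonneg_right (mul_le_mul_of_nonneg_left (supN_dualW_le _) hC) (l1N_nonneg u)
    _ = C * l1N u := by ring

end Dual

section Main

variable {ι : Type} [Fintype ι] [DecidableEq ι]

/-! ## §3 LEMMA 2.2 (2.17), `q = p = 1`: FIRST AND THIRD MEMBERS FOR `G_k(□,Ã)` WITH STAIRCASE CONTOURS -/

/-- **LEMMA 2.2 (2.17), `q = p = 1`, FIRST AND THIRD MEMBERS, FOR [B4]'s `G_k(□,Ã)` ON A FINE BOX WITH THE
STAIRCASE CONTOURS** (by duality from `B4Lemma22SupStair.lemma22_17_sup_stair` and the symmetry of `G_k(□,Ã)`):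
under the same hypotheses, for every `f`: `‖Gf‖₁ ≤ 2(d+2)c‖f‖₁` and `‖G(D^η_{Ã,μ})ᵀf‖₁ ≤ (1+ℓ₁θ)·2(d+2)c‖f‖₁`
(`(D^η_{Ã,μ})ᵀ = D^{η*}_{Ã,μ}`, the real adjoint).
[cite: Balaban1983RegularityDecay, Lemma 2.2 (2.17) p. 578, case q = p = 1] -/
theorem lemma22_17_l1_stair (F : OrthFlow ι) {ℓ₁ : ℝ} (hℓ₁ : 0 ≤ ℓ₁)
    (hLip : ∀ t (v : ι → ℝ), ((F.U t - 1) *ᵥ v) ⬝ᵥ ((F.U t - 1) *ᵥ v) ≤ (ℓ₁ * t) ^ 2 * (v ⬝ᵥ v))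
    (κ : ℝ) (d ℓ : ℕ) (hℓ : 1 ≤ ℓ) (amin aplus m2plus : ℝ) (ha : 0 < amin) :
    ∃ c : ℝ, 0 < c ∧ ∀ (k : ℕ), 1 ≤ k → ∀ (hn : 1 ≤ (ℓ + 1) ^ k) (a m2 : ℝ),
      amin ≤ a → a ≤ aplus → 0 ≤ m2 → m2 ≤ m2plus →
      ∀ (M : Fin (d + 1) → ℕ), (∀ i, 1 ≤ M i) →
      ∀ (A₀ : Fin (d + 1) → ℝ) (A' : ↥(Box d ℓ k M) → ↥(Box d ℓ k M) → ℝ) (θ θ' : ℝ),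
        0 ≤ θ → (∀ x y : ↥(Box d ℓ k M), y.1 ∈ nbrs x.1 → |κ * A' x y| ≤ θ / ((ℓ + 1) ^ k : ℕ)) →
        0 ≤ θ' → (∀ (x z y : ↥(Box d ℓ k M)) (μ : Fin (d + 1)), z.1 = x.1 + e1 μ → y.1 = z.1 + e1 μ →
          |κ * (A' y z - A' z x)| ≤ θ' / (((ℓ + 1) ^ k : ℕ) : ℝ) ^ 2 ∧
          |κ * (A' x z - A' z y)| ≤ θ' / (((ℓ + 1) ^ k : ℕ) : ℝ) ^ 2) →
        (∀ (x y : ↥(Box d ℓ k M)) (μ : Fin (d + 1)), y.1 = x.1 + e1 μ →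
          (x.1 - e1 μ ∉ Box d ℓ k M ∨ y.1 + e1 μ ∉ Box d ℓ k M) → A' x y = 0 ∧ A' y x = 0) →
        ℓ₁ ^ 2 * θ ^ 2 * ((d : ℝ) + 1) * (1 + B1.aSeq a ((ℓ : ℝ) + 1) k * ((d : ℝ) + 1))
          ≤ min 2 (B1.aSeq a ((ℓ : ℝ) + 1) k) / 4 →
        ((d : ℝ) + 2) * c * (((d : ℝ) + 1) * ℓ₁ * (θ + θ') + ((d : ℝ) + 1) * ℓ₁ * θ
          + ((d : ℝ) + 1) * ℓ₁ ^ 2 * θ ^ 2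
          + B1.aSeq a ((ℓ : ℝ) + 1) k * (ℓ₁ * (((d : ℝ) + 1) * θ) * (2 + ℓ₁ * (((d : ℝ) + 1) * θ)))) ≤ 1 / 2 →
        ∀ f : ↥(Box d ℓ k M) × ι → ℝ,
          l1N (greenA d F κ ℓ k a m2 M (baseEmb hn M) (stairContour hn M) (constBond A₀ Subtype.val + A') *ᵥ f)
              ≤ 2 * (((d : ℝ) + 2) * c) * l1N f ∧
          ∀ μ : Fin (d + 1),
            l1N ((greenA d F κ ℓ k a m2 M (baseEmb hn M) (stairContour hn M) (constBond A₀ Subtype.val + A')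
                * (derivA d F κ ℓ k M (constBond A₀ Subtype.val + A') μ)ᵀ) *ᵥ f)
              ≤ (1 + ℓ₁ * θ) * (2 * (((d : ℝ) + 2) * c)) * l1N f := by
  obtain ⟨c, hc, h⟩ := lemma22_17_sup_stair F hℓ₁ hLip κ d ℓ hℓ amin aplus m2plus ha
  refine ⟨c, hc, ?_⟩
  intro k hk hn a m2 e1' e2 e3 e4 M hM A₀ A' θ θ' hθ hA' hθ' hder hbd hsm2 hsm f
  have hs := h k hk hn a m2 e1' e2 e3 e4 M hM A₀ A' θ θ' hθ hA' hθ' hder hbd hsm2 hsm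
  have hG : (greenA d F κ ℓ k a m2 M (baseEmb hn M) (stairContour hn M) (constBond A₀ Subtype.val + A'))ᵀ
      = greenA d F κ ℓ k a m2 M (baseEmb hn M) (stairContour hn M) (constBond A₀ Subtype.val + A') :=
    b4Green_transpose F κ _ _ _ _ _ _ _
  have hC0 : 0 ≤ 2 * (((d : ℝ) + 2) * c) := mul_nonneg zero_le_two (mul_nonneg (by positivity) hc.le)
  refine ⟨?_, fun μ => ?_⟩
  · have key := l1N_transpose_le hC0 (fun Φ => le_trans
      (le_add_of_nonneg_right (Finset.sum_nonneg fun μ _ => supN_nonneg _)) (hs Φ).1) f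
    rwa [hG] at key
  · have hC1 : 0 ≤ (1 + ℓ₁ * θ) * (2 * (((d : ℝ) + 2) * c)) :=
      mul_nonneg (by nlinarith [mul_nonneg hℓ₁ hθ]) hC0
    have key := l1N_transpose_le
      (M := derivA d F κ ℓ k M (constBond A₀ Subtype.val + A') μ
        * greenA d F κ ℓ k a m2 M (baseEmb hn M) (stairContour hn M) (constBond A₀ Subtype.val + A')) hC1
      (fun Φ => by rw [← Matrix.mulVec_mulVec]; exact (hs Φ).2 μ) f
    rwa [Matrix.transpose_mul, hG] at key

end Main

end

end Literature.MathematicalPhysics.QuantumFieldTheory.Balaban1983to89.B4Lemma22DualL1
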